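import Summits.ValiantsHypothesis.ValiantsHypothesis.Theses.MonotoneRestoration

/-!
# `MonotoneRestoration.MonotoneRestorationQP` (stmt-ValiantsHypothesis-15886) — negative side: no uniform exponent

Standing disprover (cdisprove, cycle 1), from `Cruxes/MonotoneRestorationQP/Disproof.lean` §(c).
The natural strengthening of the crux that swaps `∀ f … ∃ c'` into `∃ c' ∀ f` (ONE symmetric
exponent serving every matrix-symmetric monotone-easy family) is FALSE:
`monotoneRestorationQP_uniform_false`. Already at `n = 1`, where symmetry is vacuous, a labelled
circuit (`LabelledArithCircuit`: children are SETS of gates) with `s` gates computes a polynomial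
of total degree `≤ s ^ s` (`totalDegree_eval_le`: inputs have degree `≤ 1`, sums do not raise the
degree, a product gate has `≤ s` children each with fewer strict descendants), whereas the
matrix-symmetric family `(Σ_ij x_ij)^(3^c)` has degree `3^c` and monotone complexity
`≤ 3^c (n² + 1)` (iterated cubing), i.e. satisfies the hypotheses of the crux with exponent
`2c + 2`. Information for provers: the symmetric exponent must grow with the monotone one (forced
by degree alone); `totalDegree_eval_le` is the only size lower bound for `LabelledArithCircuit`
in the tree besides Dawar–Wilsenach Thm 7.1. The refuted variant is inlined in the `¬ (…)`
statement (inner block = the crux's, verbatim, with `∃ c'` moved in front). No facts, no defs.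
[folklore]
-/

set_option linter.dupNamespace false

namespace Summit.ValiantsHypothesis.ValiantsHypothesis.Theorems.MonotoneRestorationQP.Negative

open Literature.Computability.AlgebraicComplexity MvPolynomial

noncomputable section

section DegreeGrowth

variable {K : Type*} {X Y G : Type*} (C : LabelledArithCircuit K X Y G)
  (D : G → Finset G)
  (hD : ∀ g h, h ∈ D g ↔ Relation.TransGen (fun a b => a ∈ C.children b) h g)
include hD

/-- Strict descendants are inherited along a wire. [folklore] -/
theorem desc_subset_of_mem_children {g h : G} (hh : h ∈ C.children g) : D h ⊆ D g := by
  intro x hx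
  rw [hD] at hx ⊢
  exact hx.tail hh

/-- A child is a strict descendant. [folklore] -/
theorem mem_desc_of_mem_children {g h : G} (hh : h ∈ C.children g) : h ∈ D g := by
  rw [hD]; exact Relation.TransGen.single hh

/-- Acyclicity: no gate is its own strict descendant. [folklore] -/
theorem not_mem_desc_self (g : G) : g ∉ D g := by
  rw [hD]
  exact fun h => C.wf.transGen.asymmetric g g h h

/-- A child has strictly fewer strict descendants. [folklore] -/
theorem card_desc_lt_of_mem_children {g h : G} (hh : h ∈ C.children g) :
    (D h).card < (D g).card := by
  apply Finset.card_lt_card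
  refine ⟨desc_subset_of_mem_children C D hD hh, fun hsub => ?_⟩
  exact not_mem_desc_self C D hD h (hsub (mem_desc_of_mem_children C D hD hh))

variable [CommSemiring K] [Fintype G]

/-- **Degree growth in a labelled circuit**: the polynomial at a gate `g` has total degree at most
`|G| ^ (number of strict descendants of g)`. [folklore] -/
theorem totalDegree_eval_le_pow_card_desc (g : G) :
    (C.eval g).totalDegree ≤ Fintype.card G ^ (D g).card := by
  induction g using C.wf.induction with
  | h g ih =>
    have hs : 1 ≤ Fintype.card G := Fintype.card_pos_iff.2 ⟨g⟩
    rcases hl : C.label g with x | c | _ | _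
    · rw [C.eval_of_label_var hl]
      exact (isHomogeneous_X K x).totalDegree_le.trans (Nat.one_le_pow _ _ hs)
    · rw [C.eval_of_label_const hl]; simp
    · rw [C.eval_of_label_add hl]
      refine (totalDegree_finsetSum _ _).trans (Finset.sup_le fun h hh => ?_)
      exact (ih h hh).trans
        (Nat.pow_le_pow_right hs (card_desc_lt_of_mem_children C D hD hh).le)
    · rw [C.eval_of_label_mul hl]
      have hne : (C.children g).Nonempty := by
        rw [Finset.nonempty_iff_ne_empty, Ne, ← C.isInput_iff, hl]
        exact CircuitLabel.not_isInput_mul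
      obtain ⟨h₀, hh₀⟩ := hne
      have hpos : 1 ≤ (D g).card :=
        Finset.card_pos.2 ⟨h₀, mem_desc_of_mem_children C D hD hh₀⟩
      calc (∏ h ∈ C.children g, C.eval h).totalDegree
          ≤ ∑ h ∈ C.children g, (C.eval h).totalDegree := totalDegree_finsetProd _ _
        _ ≤ ∑ h ∈ C.children g, Fintype.card G ^ ((D g).card - 1) :=
            Finset.sum_le_sum fun h hh => (ih h hh).trans
              (Nat.pow_le_pow_right hs
                (by have := card_desc_lt_of_mem_children C D hD hh; omega))
        _ = (C.children g).card * Fintype.card G ^ ((D g).card - 1) := by simp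
        _ ≤ Fintype.card G * Fintype.card G ^ ((D g).card - 1) :=
            Nat.mul_le_mul_right _ (Finset.card_le_univ _)
        _ = Fintype.card G ^ (D g).card := by
            rw [← pow_succ']; congr 1; omega

end DegreeGrowth

/-- **Degree growth, size form**: a labelled arithmetic circuit with `s` gates computes, at every
gate, a polynomial of total degree at most `s ^ s`. [folklore] -/
theorem totalDegree_eval_le {K : Type*} {X Y G : Type*} [CommSemiring K] [Fintype G]
    (C : LabelledArithCircuit K X Y G) (g : G) :
    (C.eval g).totalDegree ≤ Fintype.card G ^ Fintype.card G := by
  classical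
  have hs : 1 ≤ Fintype.card G := Fintype.card_pos_iff.2 ⟨g⟩
  have h := totalDegree_eval_le_pow_card_desc C
    (fun g => Finset.univ.filter fun h => Relation.TransGen (fun a b => a ∈ C.children b) h g)
    (fun g h => by simp) g
  exact h.trans (Nat.pow_le_pow_right hs (Finset.card_le_univ _))

/-- **(c1) No uniform symmetric exponent**: the strengthening of `MonotoneRestorationQP` with
`∃ c'` in front of `∀ f` is false. Given `c'`, put `S = 2^(c'^c')` and take the matrix-symmetric
family `f n = (Σ_ij x_ij)^(3^(S·S))` (degree and monotone complexity `≤ (n+2)^(2 S² + 2)`); at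
`n = 1` it is `x₀₀^(3^(S·S))`, but a circuit with `s ≤ 2^((log₂ 1 + c')^c') = S` gates has degree
`≤ s^s ≤ S^S < 3^(S·S)`. -/
theorem monotoneRestorationQP_uniform_false :
    ¬ ∃ c' : ℕ, ∀ f : (n : ℕ) → MvPolynomial (Fin n × Fin n) NNReal,
      (∀ (n : ℕ) (σ τ : Equiv.Perm (Fin n)),
        MvPolynomial.rename (fun p : Fin n × Fin n => (σ p.1, τ p.2)) (f n) = f n) →
      (∃ c : ℕ, ∀ n : ℕ, (f n).totalDegree ≤ (n + 2) ^ c ∧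
        complexity (k := NNReal) (f n) ≤ (n + 2) ^ c) →
      ∀ n : ℕ, ∃ (G : Type) (_ : Fintype G)
        (C : LabelledArithCircuit ℂ (Fin n × Fin n) Unit G),
        C.IsSymmetric (Equiv.Perm (Fin n)) ∧
          C.eval (C.output ()) = MvPolynomial.map (Complex.ofRealHom.comp NNReal.toRealHom) (f n) ∧
          Fintype.card G ≤ 2 ^ ((Nat.log 2 n + c') ^ c') := by
  rintro ⟨c', h⟩
  -- the witness family `(Σ_ij x_ij)^(3^c)`
  set powSum : ℕ → (n : ℕ) → MvPolynomial (Fin n × Fin n) NNReal :=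
    fun c n => (∑ p : Fin n × Fin n, X p) ^ (3 ^ c) with hpowSum
  -- matrix symmetry
  have hsymm : ∀ (c n : ℕ) (σ τ : Equiv.Perm (Fin n)),
      MvPolynomial.rename (fun p : Fin n × Fin n => (σ p.1, τ p.2)) (powSum c n) = powSum c n := by
    intro c n σ τ
    simp only [hpowSum, map_pow, map_sum, rename_X]
    congr 1
    exact Equiv.sum_comp (Equiv.prodCongr σ τ) (fun p : Fin n × Fin n => (X p : MvPolynomial _ NNReal))
  -- monotone complexity by iterated cubing: `L((Σ x)^(3^t)) + 1 ≤ 3^t (n² + 1)`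
  have hcx : ∀ t n : ℕ, complexity (k := NNReal) (powSum t n) + 1 ≤ 3 ^ t * (n * n + 1) := by
    intro t n
    induction t with
    | zero =>
      have h := complexity_finset_sum_le (k := NNReal) (Finset.univ : Finset (Fin n × Fin n))
        (fun p => (X p : MvPolynomial (Fin n × Fin n) NNReal))
      have hX : ∀ p : Fin n × Fin n,
          complexity (X p : MvPolynomial (Fin n × Fin n) NNReal) = 0 := complexity_X_holds
      simp only [hX, Finset.sum_const_zero, zero_add, Finset.card_univ, Fintype.card_prod,
        Fintype.card_fin] at h
      simpa [hpowSum] using h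
    | succ t ih =>
      have hmul := complexity_mul_le_holds (k := NNReal) (σ := Fin n × Fin n)
      have h3 : powSum (t + 1) n = powSum t n * powSum t n * powSum t n := by
        simp only [hpowSum]; rw [pow_succ, pow_mul]; ring
      rw [h3]
      calc complexity (powSum t n * powSum t n * powSum t n) + 1
          ≤ (complexity (powSum t n * powSum t n) + complexity (powSum t n) + 1) + 1 := by
            gcongr; exact hmul _ _
        _ ≤ ((complexity (powSum t n) + complexity (powSum t n) + 1) +
              complexity (powSum t n) + 1) + 1 := by
            gcongr; exact hmul _ _
        _ = 3 * (complexity (k := NNReal) (powSum t n) + 1) := by ring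
        _ ≤ 3 * (3 ^ t * (n * n + 1)) := Nat.mul_le_mul_left 3 ih
        _ = 3 ^ (t + 1) * (n * n + 1) := by ring
  -- the hypotheses of the crux, with exponent `2c + 2`
  have hmono : ∀ c : ℕ, ∃ e : ℕ, ∀ n : ℕ, (powSum c n).totalDegree ≤ (n + 2) ^ e ∧
      complexity (k := NNReal) (powSum c n) ≤ (n + 2) ^ e := by
    intro c
    refine ⟨2 * c + 2, fun n => ?_⟩
    have h3 : 3 ^ c ≤ (n + 2) ^ (2 * c) := by
      rw [pow_mul]
      refine Nat.pow_le_pow_left ?_ c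
      have : (n + 2) ^ 2 = n * n + 4 * n + 4 := by ring
      omega
    have hsq : n * n + 1 ≤ (n + 2) ^ 2 := by nlinarith
    constructor
    · calc (powSum c n).totalDegree ≤ 3 ^ c * (∑ p : Fin n × Fin n, X p).totalDegree :=
            totalDegree_pow _ _
        _ ≤ 3 ^ c * 1 := by
            gcongr
            refine (totalDegree_finsetSum _ _).trans (Finset.sup_le fun p _ => ?_)
            exact (isHomogeneous_X NNReal p).totalDegree_le
        _ ≤ (n + 2) ^ (2 * c) * (n + 2) ^ 2 := by
            rw [mul_one]
            exact le_mul_of_le_of_one_le h3 (Nat.one_le_pow _ _ (by omega))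
        _ = (n + 2) ^ (2 * c + 2) := by rw [← pow_add]
    · have h := hcx c n
      calc complexity (powSum c n) ≤ 3 ^ c * (n * n + 1) := by omega
        _ ≤ (n + 2) ^ (2 * c) * (n + 2) ^ 2 := Nat.mul_le_mul h3 hsq
        _ = (n + 2) ^ (2 * c + 2) := by rw [← pow_add]
  -- at `n = 1` the complexified witness is `x₀₀ ^ (3^c)`, of degree `3^c`
  have hdeg1 : ∀ c : ℕ, (MvPolynomial.map (Complex.ofRealHom.comp NNReal.toRealHom)
      (powSum c 1)).totalDegree = 3 ^ c := by
    intro c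
    simp only [hpowSum, map_pow, map_sum, map_X]
    rw [Fintype.sum_subsingleton _ ((0 : Fin 1), (0 : Fin 1))]
    exact totalDegree_X_pow (R := ℂ) _ _
  -- the contradiction
  set S : ℕ := 2 ^ (c' ^ c') with hS
  obtain ⟨G, inst, C, -, heval, hcard⟩ := h (powSum (S * S)) (hsymm _) (hmono _) 1
  have hdeg := totalDegree_eval_le C (C.output ())
  rw [heval, hdeg1] at hdeg
  have hcard' : Fintype.card G ≤ S := by simpa [hS] using hcard
  have hs : 1 ≤ Fintype.card G := Fintype.card_pos_iff.2 ⟨C.output ()⟩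
  have hS1 : 1 ≤ S := Nat.one_le_two_pow
  have h1 : Fintype.card G ^ Fintype.card G ≤ S ^ S :=
    (Nat.pow_le_pow_left hcard' _).trans (Nat.pow_le_pow_right hS1 hcard')
  have h2 : S ^ S < 3 ^ (S * S) := by
    rw [pow_mul]
    exact Nat.pow_lt_pow_left (Nat.lt_pow_self (by norm_num)) (by omega)
  omega

end

end Summit.ValiantsHypothesis.ValiantsHypothesis.Theorems.MonotoneRestorationQP.Negative
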